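import Mathlib
import HarnessLib
import Summits.ValiantsHypothesis.ValiantsHypothesis.Theorems.MonotoneRestorationOrbitRestorationQPSupportOneProducts

/-!
# Two-row-local products `Π_{a ≠ a'} (β₀ + δU + β₁ R_a + β₂ R_{a'})` — e.g. the DISCRIMINANT OF THE ROW SUMS — are narrow
# with treewidth `≤ 3` (SPAN currency, end to end; the first case where INJECTIVE placements matter)

Route MonotoneRestoration, crux `OrbitRestorationQP` (stmt-ValiantsHypothesis-18293), SPAN-currency lane of the open
sub-rung A_∞ (`stub_sigmaPiSigmaValue`); evidence note `SPAN-CURRENCY-A1-g7g4.md` §2, §5.  Helper (`--supports`),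
def-free.

For a core of TWO rows the passage "all placements → injective placements" (§5, lemma INJ) is a single
subtraction: `Σ_{a ≠ a'} (ℓ^{a,a'})^m = Σ_{a,a'} (ℓ^{a,a'})^m − Σ_a (ℓ^{a,a})^m`, and the diagonal term is the all-placements
power sum of the MERGED one-row datum (`β₁ + β₂`).  Both are instances of the landed affine engine
(`CorePatterns.sum_placements_pow_affineLocalForm_mem_narrowSpan`), and Newton in span currency
(`NarrowSpanNewton.prod_mem_narrowSpan_of_psum_mem`) finishes:

* `sum_offDiag_pow_twoRowForm_mem_narrowSpan` — the injective-placement power sums (INJ for `r = 2`, `c = 0`);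
* **`prod_twoRowLocal_mem_narrowSpan_three`** — `Π_{a ≠ a'} (β₀ + δ U + β₁ R_a + β₂ R_{a'}) ∈ span_ℂ {hom_{F,n} : tw F ≤ 3}`
  for all `n` and coefficients (an UNTWISTED orbit product over the ordered pairs of distinct rows);
* **`rowSumDiscriminant_mem_narrowSpan_three`** — `Π_{a ≠ a'} (R_a − R_{a'})` (= `± Disc(R_1, …, R_n)`, a matrix-symmetric
  `ΠΣ` family with `n(n−1)` factors of width `n`) lies in `span_ℂ {hom_{F,n} : tw F ≤ 3}`.

Honest label: a sub-class of the `ΠΣ` sub-rung; the stub, the crux and VP ≠ VNP are not moved.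
-/

noncomputable section

-- `Summit.ValiantsHypothesis.ValiantsHypothesis.…` is the tree's single-conjunct layout (Sub = Summit).
set_option linter.dupNamespace false

namespace Summit.ValiantsHypothesis.ValiantsHypothesis.Theorems

namespace TwoRowLocalProducts

open MvPolynomial Finset
open Literature.Computability.AlgebraicComplexity (homPoly)
open Literature.Combinatorics.SimpleGraph (treewidth)

/-- Sums over `Fin 2 → Fin n` are double sums over `Fin n`. [folklore] -/
theorem sum_fin_two_arrow {M : Type*} [AddCommMonoid M] (n : ℕ) (F : (Fin 2 → Fin n) → M) :
    ∑ φ : Fin 2 → Fin n, F φ = ∑ a : Fin n, ∑ a' : Fin n, F ![a, a'] := by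
  rw [← (piFinTwoEquiv fun _ : Fin 2 => Fin n).symm.sum_comp, Fintype.sum_prod_type]
  refine Finset.sum_congr rfl fun a _ => Finset.sum_congr rfl fun a' _ => ?_
  exact congrArg F (by ext i; fin_cases i <;> rfl)

/-- **All-placements power sums of the two-row form** (affine engine, core `Fin 2 × Fin 0`). [folklore] -/
theorem sum_all_pow_twoRowForm_mem_narrowSpan (n m : ℕ) (β₀ δ β₁ β₂ : ℂ) :
    (∑ a : Fin n, ∑ a' : Fin n,
      (C β₀ + C δ * ∑ i : Fin n, ∑ j : Fin n, (X (i, j) : MvPolynomial (Fin n × Fin n) ℂ) +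
        (C β₁ * ∑ j : Fin n, (X (a, j) : MvPolynomial (Fin n × Fin n) ℂ) +
          C β₂ * ∑ j : Fin n, (X (a', j) : MvPolynomial (Fin n × Fin n) ℂ))) ^ m) ∈
      Submodule.span ℂ {p : MvPolynomial (Fin n × Fin n) ℂ |
        ∃ (a b : ℕ) (E : Multiset (Fin a × Fin b)),
          treewidth (SimpleGraph.fromRel fun u v : Fin a ⊕ Fin b =>
            ∃ e ∈ E, u = Sum.inl e.1 ∧ v = Sum.inr e.2) ≤ 3 ∧ p = homPoly E n ℂ} := by
  have h := CorePatterns.sum_placements_pow_affineLocalForm_mem_narrowSpan n 2 0 m β₀ δ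
    (fun _ => 0) ![β₁, β₂] (fun _ => 0)
  rw [sum_fin_two_arrow] at h
  convert h using 4 with a _ a'
  simp

/-- The diagonal (merged one-row datum `β₁ + β₂`): all-placements power sums, treewidth `≤ 3` (from `≤ 2`). [folklore] -/
theorem sum_diag_pow_twoRowForm_mem_narrowSpan (n m : ℕ) (β₀ δ β₁ β₂ : ℂ) :
    (∑ a : Fin n,
      (C β₀ + C δ * ∑ i : Fin n, ∑ j : Fin n, (X (i, j) : MvPolynomial (Fin n × Fin n) ℂ) +
        (C β₁ * ∑ j : Fin n, (X (a, j) : MvPolynomial (Fin n × Fin n) ℂ) +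
          C β₂ * ∑ j : Fin n, (X (a, j) : MvPolynomial (Fin n × Fin n) ℂ))) ^ m) ∈
      Submodule.span ℂ {p : MvPolynomial (Fin n × Fin n) ℂ |
        ∃ (a b : ℕ) (E : Multiset (Fin a × Fin b)),
          treewidth (SimpleGraph.fromRel fun u v : Fin a ⊕ Fin b =>
            ∃ e ∈ E, u = Sum.inl e.1 ∧ v = Sum.inr e.2) ≤ 3 ∧ p = homPoly E n ℂ} := by
  have h := CorePatterns.sum_placements_pow_affineLocalForm_mem_narrowSpan n 1 0 m β₀ δ
    (fun _ => 0) (fun _ => β₁ + β₂) (fun _ => 0)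
  rw [SupportOneProducts.sum_fin_one_arrow] at h
  have hmono : Submodule.span ℂ {p : MvPolynomial (Fin n × Fin n) ℂ |
        ∃ (a b : ℕ) (E : Multiset (Fin a × Fin b)),
          treewidth (SimpleGraph.fromRel fun u v : Fin a ⊕ Fin b =>
            ∃ e ∈ E, u = Sum.inl e.1 ∧ v = Sum.inr e.2) ≤ 1 + 0 + 1 ∧ p = homPoly E n ℂ} ≤
      Submodule.span ℂ {p : MvPolynomial (Fin n × Fin n) ℂ |
        ∃ (a b : ℕ) (E : Multiset (Fin a × Fin b)),
          treewidth (SimpleGraph.fromRel fun u v : Fin a ⊕ Fin b =>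
            ∃ e ∈ E, u = Sum.inl e.1 ∧ v = Sum.inr e.2) ≤ 3 ∧ p = homPoly E n ℂ} := by
    refine Submodule.span_mono ?_
    rintro p ⟨a, b, E, hE, rfl⟩
    exact ⟨a, b, E, hE.trans (by norm_num), rfl⟩
  have h' := hmono h
  convert h' using 4 with a
  simp [map_add, add_mul, add_assoc]

/-- **INJ for two rows: the off-diagonal (injective-placement) power sums are narrow.** [folklore] -/
theorem sum_offDiag_pow_twoRowForm_mem_narrowSpan (n m : ℕ) (β₀ δ β₁ β₂ : ℂ) :
    (∑ p : {p : Fin n × Fin n // p.1 ≠ p.2},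
      (C β₀ + C δ * ∑ i : Fin n, ∑ j : Fin n, (X (i, j) : MvPolynomial (Fin n × Fin n) ℂ) +
        (C β₁ * ∑ j : Fin n, (X (p.1.1, j) : MvPolynomial (Fin n × Fin n) ℂ) +
          C β₂ * ∑ j : Fin n, (X (p.1.2, j) : MvPolynomial (Fin n × Fin n) ℂ))) ^ m) ∈
      Submodule.span ℂ {p : MvPolynomial (Fin n × Fin n) ℂ |
        ∃ (a b : ℕ) (E : Multiset (Fin a × Fin b)),
          treewidth (SimpleGraph.fromRel fun u v : Fin a ⊕ Fin b =>
            ∃ e ∈ E, u = Sum.inl e.1 ∧ v = Sum.inr e.2) ≤ 3 ∧ p = homPoly E n ℂ} := by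
  -- off-diagonal = all − diagonal
  set G : Fin n × Fin n → MvPolynomial (Fin n × Fin n) ℂ := fun p =>
    (C β₀ + C δ * ∑ i : Fin n, ∑ j : Fin n, (X (i, j) : MvPolynomial (Fin n × Fin n) ℂ) +
      (C β₁ * ∑ j : Fin n, (X (p.1, j) : MvPolynomial (Fin n × Fin n) ℂ) +
        C β₂ * ∑ j : Fin n, (X (p.2, j) : MvPolynomial (Fin n × Fin n) ℂ))) ^ m with hG
  have h1 : (∑ p : {p : Fin n × Fin n // p.1 ≠ p.2}, G p.1) =
      ∑ p ∈ (univ : Finset (Fin n × Fin n)).filter (fun p => p.1 ≠ p.2), G p :=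
    (Finset.sum_subtype _ (fun p => by simp) G).symm
  have h2 : (∑ p ∈ (univ : Finset (Fin n × Fin n)).filter (fun p => p.1 = p.2), G p) = ∑ a : Fin n, G (a, a) := by
    rw [Finset.sum_filter, Fintype.sum_prod_type]
    simp
  have h3 : (∑ p ∈ (univ : Finset (Fin n × Fin n)).filter (fun p => p.1 = p.2), G p) +
      ∑ p ∈ (univ : Finset (Fin n × Fin n)).filter (fun p => p.1 ≠ p.2), G p = ∑ p, G p :=
    Finset.sum_filter_add_sum_filter_not _ _ _
  have hsub : (∑ p : {p : Fin n × Fin n // p.1 ≠ p.2}, G p.1) =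
      (∑ p : Fin n × Fin n, G p) - ∑ a : Fin n, G (a, a) := by
    rw [h1, ← h2]
    exact eq_sub_of_add_eq' h3
  show (∑ p : {p : Fin n × Fin n // p.1 ≠ p.2}, G p.1) ∈ _
  rw [hsub, Fintype.sum_prod_type]
  exact Submodule.sub_mem _ (sum_all_pow_twoRowForm_mem_narrowSpan n m β₀ δ β₁ β₂)
    (sum_diag_pow_twoRowForm_mem_narrowSpan n m β₀ δ β₁ β₂)

/-- **Two-row-local products are narrow with treewidth `≤ 3`.**  For all `n` and all coefficients,
`Π_{a ≠ a'} (β₀ + δ U + β₁ R_a + β₂ R_{a'}) ∈ span_ℂ {hom_{F,n} : tw F ≤ 3}`. [folklore; cite: DwivediPagoSeppelt2026, §8] -/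
theorem prod_twoRowLocal_mem_narrowSpan_three (n : ℕ) (β₀ δ β₁ β₂ : ℂ) :
    (∏ p : {p : Fin n × Fin n // p.1 ≠ p.2},
      (C β₀ + C δ * ∑ i : Fin n, ∑ j : Fin n, (X (i, j) : MvPolynomial (Fin n × Fin n) ℂ) +
        (C β₁ * ∑ j : Fin n, (X (p.1.1, j) : MvPolynomial (Fin n × Fin n) ℂ) +
          C β₂ * ∑ j : Fin n, (X (p.1.2, j) : MvPolynomial (Fin n × Fin n) ℂ)))) ∈
      Submodule.span ℂ {p : MvPolynomial (Fin n × Fin n) ℂ |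
        ∃ (a b : ℕ) (E : Multiset (Fin a × Fin b)),
          treewidth (SimpleGraph.fromRel fun u v : Fin a ⊕ Fin b =>
            ∃ e ∈ E, u = Sum.inl e.1 ∧ v = Sum.inr e.2) ≤ 3 ∧ p = homPoly E n ℂ} :=
  NarrowSpanNewton.prod_mem_narrowSpan_of_psum_mem n 3 _ fun m =>
    sum_offDiag_pow_twoRowForm_mem_narrowSpan n m β₀ δ β₁ β₂

/-- **The discriminant of the row sums is narrow with treewidth `≤ 3`**: `Π_{a ≠ a'} (R_a − R_{a'})` (the matrix-symmetric
`ΠΣ` family `± Disc(R_1, …, R_n)`, `n(n-1)` affine factors of width `n`) lies in `span_ℂ {hom_{F,n} : tw F ≤ 3}`.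
[folklore; cite: DwivediPagoSeppelt2026, §8] -/
theorem rowSumDiscriminant_mem_narrowSpan_three (n : ℕ) :
    (∏ p : {p : Fin n × Fin n // p.1 ≠ p.2},
      ((∑ j : Fin n, (X (p.1.1, j) : MvPolynomial (Fin n × Fin n) ℂ)) -
        ∑ j : Fin n, (X (p.1.2, j) : MvPolynomial (Fin n × Fin n) ℂ))) ∈
      Submodule.span ℂ {p : MvPolynomial (Fin n × Fin n) ℂ |
        ∃ (a b : ℕ) (E : Multiset (Fin a × Fin b)),
          treewidth (SimpleGraph.fromRel fun u v : Fin a ⊕ Fin b =>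
            ∃ e ∈ E, u = Sum.inl e.1 ∧ v = Sum.inr e.2) ≤ 3 ∧ p = homPoly E n ℂ} := by
  have h := prod_twoRowLocal_mem_narrowSpan_three n 0 0 1 (-1)
  have hfac : ∀ p : {p : Fin n × Fin n // p.1 ≠ p.2},
      (C (0 : ℂ) + C (0 : ℂ) * ∑ i : Fin n, ∑ j : Fin n, (X (i, j) : MvPolynomial (Fin n × Fin n) ℂ) +
        (C (1 : ℂ) * ∑ j : Fin n, (X (p.1.1, j) : MvPolynomial (Fin n × Fin n) ℂ) +
          C (-1 : ℂ) * ∑ j : Fin n, (X (p.1.2, j) : MvPolynomial (Fin n × Fin n) ℂ))) =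
      (∑ j : Fin n, (X (p.1.1, j) : MvPolynomial (Fin n × Fin n) ℂ)) -
        ∑ j : Fin n, (X (p.1.2, j) : MvPolynomial (Fin n × Fin n) ℂ) := by
    intro p
    simp only [map_zero, map_one, map_neg, zero_mul, zero_add, one_mul, neg_mul, add_zero]
    ring
  simp_rw [hfac] at h
  exact h

end TwoRowLocalProducts

end Summit.ValiantsHypothesis.ValiantsHypothesis.Theorems

end
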